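import Summits.PneNP.PneNP.Theorems.ExpanderLinearGeneratorsResKSample
import HarnessLib

/-!
# The `Res(k)` rung for expanding linear systems, VIII: disjoint terms get satisfied

Support file for `stmt-PneNP-11443`. The probabilistic input of the switching lemma for the
expansion-preserving restriction `rho` (file VII): if a `k`-DNF contains `s` pairwise
variable-disjoint consistent terms, then, over the uniform sample space
`(Fin V → Fin M) × (Fin V → Bool)`, the number of GOOD sample points at which NO term of the
family is satisfied by `rho` is at most `M^V 2^V (1 - 2^{-(k+1)} M^{-k})^s`
(`card_good_forall_not_satBy_le`), provided `2k ≤ c` (`k ≥ 1`, `M ≥ 1`, `n ≤ V`).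

For a fixed good `u` (`card_forall_not_satBy_le`): the LANDED terms (all variables in `J(u)`) are
fully assigned; choose a peeling order of the closure avoiding their variable set `W` (file II: at
most `|W|/c ≤ (k/c)·#landed ≤ #landed/2` pivots inside `W`), so at least half of the landed terms
are CLEAN (contain no pivot); by the fiber lemma the values may be computed along this order, and
on clean terms they are the independent fair bits `y`, whence the exact product formula of file VI.
Summing over `u` is the generating-function bound of file VI.

[Segerlind–Buss–Impagliazzo 2004, §3; Alekhnovich 2011, §3–4]
-/

namespace Summit.PneNP.PneNP.Theorems.ResKRestriction

open Finset Literature.Computability.Complexity Literature.Computability.MetaComplexity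

variable {m n : ℕ} {E : Fin m → LinEqMod 2 n} {r c : ℝ} {V M : ℕ}

/-- A landed term has all its variables in `J(u)`, hence assigned. [folklore] -/
theorem mem_Aset_of_landed {u : Fin V → Fin M} {t : Finset (Literal ℕ)} (hV : ∀ l ∈ t, l.1 < V)
    (ht : Landed u t) {l : Literal ℕ} (hl : l ∈ t) : l.1 ∈ Aset E r c V M u := by
  refine Jset_subset_Aset u (mem_Jset.2 ⟨hV l hl, ht ⟨l.1, hV l hl⟩ ?_⟩)
  simp only [tfin, Finset.mem_filter, Finset.mem_univ, true_and]
  exact mem_tvars.2 ⟨l.2, by simp [hl]⟩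

/-- On a landed term, `rho` satisfies the term iff the values do. [folklore] -/
theorem satBy_rho_iff_of_landed {u : Fin V → Fin M} {t : Finset (Literal ℕ)} (hV : ∀ l ∈ t, l.1 < V)
    (ht : Landed u t) (y : Fin V → Bool) :
    SatBy (rho E r c V M u y) t ↔ ∀ l ∈ t, vals E r c V M u y l.1 = l.2 := by
  refine forall₂_congr fun l hl => ?_
  rw [rho_of_mem y (mem_Aset_of_landed hV ht hl)]
  simp

/-- The elementary inequality `1 - a ≤ (1 - a/2)²`. [folklore] -/
theorem one_sub_le_sq_one_sub_half (a : ℝ) : 1 - a ≤ (1 - a / 2) ^ 2 := by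
  nlinarith [sq_nonneg a]

/-- `SatBy` is decidable. [folklore] -/
instance (α : ℕ → Option Bool) (t : Finset (Literal ℕ)) : Decidable (SatBy α t) := by
  unfold SatBy; infer_instance

section PerU

variable (hexp : IsBoundaryExpander (rowVars E) r c) (hc : 0 < c)
include hexp hc

/-- **Fixed good `u`: few value assignments satisfy no term.** For a good sample point `u` and a
pairwise variable-disjoint family `D` of consistent terms of size `≤ k` (`1 ≤ k`, `2k ≤ c`,
variables `< V`, `n ≤ V`), the number of `y` such that `rho u y` satisfies no term of `D` is at most
`2^V (1 - 2^{-(k+1)})^{#landed terms}`. [Segerlind–Buss–Impagliazzo 2004, §3; Alekhnovich 2011, §4]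
[folklore] -/
theorem card_forall_not_satBy_le (hnV : n ≤ V) {k : ℕ} (hk1 : 1 ≤ k) (hkc : 2 * (k : ℝ) ≤ c)
    {u : Fin V → Fin M} (hu : Good (n := n) r c V M u)
    (D : Finset (Finset (Literal ℕ))) (hdisj : PairwiseDisjointVars D)
    (hcons : ∀ t ∈ D, TConsistent t) (hk : ∀ t ∈ D, t.card ≤ k) (hV : ∀ t ∈ D, ∀ l ∈ t, l.1 < V) :
    ((((Finset.univ : Finset (Fin V → Bool)).filter fun y =>
        ∀ t ∈ D, ¬ SatBy (rho E r c V M u y) t).card : ℝ)) ≤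
      (2 : ℝ) ^ V * (1 - ((2 : ℝ) ^ (k + 1))⁻¹) ^ (D.filter (Landed u)).card := by
  classical
  -- landed terms, their variables, and a peeling order avoiding them
  set Du := D.filter (Landed u) with hDu
  set W : Finset ℕ := Du.biUnion tvars with hW
  obtain ⟨L, hL, hLW⟩ := exists_isPeeling_avoiding (E := E) hc (Icl E r c V M u)
    (fun I' hI' => expands_of_subset_Icl hexp hc hu hI') W
  -- clean landed terms: no pivot of `L` among their variables
  set Dc := Du.filter fun t => ∀ e ∈ L, ((e.2 : ℕ)) ∉ tvars t with hDc
  have hDcD : Dc ⊆ D := (Finset.filter_subset _ _).trans (Finset.filter_subset _ _)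
  -- (1) at least half of the landed terms are clean
  have hhalf : Du.card ≤ 2 * Dc.card := by
    set Dn := Du.filter fun t => ¬ ∀ e ∈ L, ((e.2 : ℕ)) ∉ tvars t with hDn
    have hsplit : Dc.card + Dn.card = Du.card := Finset.card_filter_add_card_filter_not _
    -- unclean terms inject into the pivots of `L` inside `W`
    have hinj : Dn.card ≤ ((L.filter fun e => ((e.2 : ℕ) ∈ W)).toFinset).card := by
      have hex : ∀ t ∈ Dn, ∃ e ∈ L, ((e.2 : ℕ)) ∈ tvars t := by
        intro t ht
        rw [hDn, Finset.mem_filter] at ht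
        push Not at ht
        exact ht.2
      rcases Dn.eq_empty_or_nonempty with hDn0 | ⟨t₀, ht₀⟩
      · rw [hDn0]; simp
      obtain ⟨e₀, -, -⟩ := hex t₀ ht₀
      haveI : Nonempty (Fin m × Fin n) := ⟨e₀⟩
      choose! f hf using hex
      refine Finset.card_le_card_of_injOn f (fun t ht => ?_) ?_
      · rw [Finset.mem_coe, List.mem_toFinset, List.mem_filter]
        refine ⟨(hf t ht).1, decide_eq_true ?_⟩
        rw [hW, Finset.mem_biUnion]
        exact ⟨t, (Finset.mem_filter.1 ht).1, (hf t ht).2⟩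
      · intro t ht t' ht' hff
        by_contra hne
        have h1 := (hf t ht).2
        have h2 := (hf t' ht').2
        rw [hff] at h1
        have hd := hdisj t ((Finset.filter_subset _ _).trans (Finset.filter_subset _ _) ht) t'
          ((Finset.filter_subset _ _).trans (Finset.filter_subset _ _) ht') hne
        exact Finset.disjoint_left.1 hd h1 h2
    have hlen : ((L.filter fun e => ((e.2 : ℕ) ∈ W)).toFinset).card ≤
        (L.filter fun e => ((e.2 : ℕ) ∈ W)).length := List.toFinset_card_le _
    have hWcard : (W.card : ℝ) ≤ k * Du.card := by
      have : W.card ≤ Du.card * k := by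
        calc W.card ≤ ∑ t ∈ Du, (tvars t).card := Finset.card_biUnion_le
          _ ≤ ∑ t ∈ Du, k := Finset.sum_le_sum fun t ht =>
              (card_tvars_le t).trans (hk t (Finset.mem_filter.1 ht).1)
          _ = Du.card * k := by rw [Finset.sum_const, smul_eq_mul]
      have : (W.card : ℝ) ≤ (Du.card * k : ℕ) := by exact_mod_cast this
      rw [Nat.cast_mul] at this; linarith
    have h1 : c * (Dn.card : ℝ) ≤ k * Du.card := by
      have : (Dn.card : ℝ) ≤ (L.filter fun e => ((e.2 : ℕ) ∈ W)).length := by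
        exact_mod_cast hinj.trans hlen
      nlinarith
    have h2 : 2 * (k : ℝ) * Dn.card ≤ k * Du.card := by nlinarith
    have hkpos : (0 : ℝ) < k := by exact_mod_cast hk1
    have h3 : 2 * (Dn.card : ℝ) ≤ Du.card := by nlinarith
    have h4 : 2 * Dn.card ≤ Du.card := by exact_mod_cast h3
    omega
  -- (2) no term of `D` satisfied ⇒ no clean landed term satisfied by the values
  let Q : (ℕ → Bool) → Prop := fun g => ∀ t ∈ Dc, ¬ ∀ l ∈ t, g l.1 = l.2
  have hstep2 : ((Finset.univ : Finset (Fin V → Bool)).filter fun y =>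
        ∀ t ∈ D, ¬ SatBy (rho E r c V M u y) t).card ≤
      ((Finset.univ : Finset (Fin V → Bool)).filter fun y => Q (vals E r c V M u y)).card := by
    refine Finset.card_le_card fun y hy => ?_
    rw [Finset.mem_filter] at hy ⊢
    refine ⟨hy.1, fun t ht hsat => hy.2 t (hDcD ht) ?_⟩
    have htu : Landed u t := (Finset.mem_filter.1 (Finset.mem_filter.1 ht).1).2
    exact (satBy_rho_iff_of_landed (hV t (hDcD ht)) htu y).2 hsat
  -- (3) switch to the peeling order avoiding `W`; there the values on clean terms are the bits `y`
  have hstep3 : ((Finset.univ : Finset (Fin V → Bool)).filter fun y => Q (vals E r c V M u y)).card =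
      ((Finset.univ : Finset (Fin V → Bool)).filter fun y => ∀ t ∈ Dc, ¬ TSat y t).card := by
    rw [card_filter_vals_eq hexp hc hu hnV hL Q]
    congr 1
    ext y
    simp only [Finset.mem_filter, Finset.mem_univ, true_and, Q, TSat]
    refine forall₂_congr fun t ht => not_congr (forall₂_congr fun l hl => ?_)
    rw [solve_apply_of_forall_ne L _ fun e he heq => ?_]
    have hclean := (Finset.mem_filter.1 ht).2 e he
    exact hclean (heq ▸ mem_tvars.2 ⟨l.2, by simp [hl]⟩)
  -- (4) exact product count on clean terms, and the numerical bound
  have hDc_disj : PairwiseDisjointVars Dc := fun t ht t' ht' hne => hdisj t (hDcD ht) t' (hDcD ht') hne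
  have hcount := card_forall_not_tsat Dc hDc_disj (fun t ht => hcons t (hDcD ht))
    (fun t ht => hV t (hDcD ht))
  have hμ0 : (0 : ℝ) ≤ 1 - ((2 : ℝ) ^ (k + 1))⁻¹ := by
    have : ((2 : ℝ) ^ (k + 1))⁻¹ ≤ 1 := inv_le_one_of_one_le₀ (one_le_pow₀ (by norm_num))
    linarith
  have hμ1 : 1 - ((2 : ℝ) ^ (k + 1))⁻¹ ≤ 1 := by
    have : (0 : ℝ) ≤ ((2 : ℝ) ^ (k + 1))⁻¹ := by positivity
    linarith
  have hprod : ∏ t ∈ Dc, (1 - ((2 : ℝ) ^ t.card)⁻¹) ≤ ((1 - ((2 : ℝ) ^ (k + 1))⁻¹) ^ 2) ^ Dc.card := by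
    rw [← Finset.prod_const]
    refine Finset.prod_le_prod (fun t _ => ?_) fun t ht => ?_
    · have : ((2 : ℝ) ^ t.card)⁻¹ ≤ 1 := inv_le_one_of_one_le₀ (one_le_pow₀ (by norm_num))
      linarith
    · have h1 : ((2 : ℝ) ^ k)⁻¹ ≤ ((2 : ℝ) ^ t.card)⁻¹ := by
        apply inv_anti₀ (by positivity)
        exact pow_le_pow_right₀ (by norm_num) (hk t (hDcD ht))
      have h2 : ((2 : ℝ) ^ (k + 1))⁻¹ = ((2 : ℝ) ^ k)⁻¹ / 2 := by
        rw [pow_succ]; field_simp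
      calc 1 - ((2 : ℝ) ^ t.card)⁻¹ ≤ 1 - ((2 : ℝ) ^ k)⁻¹ := by linarith
        _ ≤ (1 - ((2 : ℝ) ^ k)⁻¹ / 2) ^ 2 := one_sub_le_sq_one_sub_half _
        _ = (1 - ((2 : ℝ) ^ (k + 1))⁻¹) ^ 2 := by rw [h2]
  calc ((((Finset.univ : Finset (Fin V → Bool)).filter fun y =>
          ∀ t ∈ D, ¬ SatBy (rho E r c V M u y) t).card : ℝ))
      ≤ ((Finset.univ : Finset (Fin V → Bool)).filter fun y => ∀ t ∈ Dc, ¬ TSat y t).card := by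
        rw [← hstep3]; exact_mod_cast hstep2
    _ = (2 : ℝ) ^ V * ∏ t ∈ Dc, (1 - ((2 : ℝ) ^ t.card)⁻¹) := hcount
    _ ≤ (2 : ℝ) ^ V * ((1 - ((2 : ℝ) ^ (k + 1))⁻¹) ^ 2) ^ Dc.card := by gcongr
    _ = (2 : ℝ) ^ V * (1 - ((2 : ℝ) ^ (k + 1))⁻¹) ^ (2 * Dc.card) := by rw [pow_mul]
    _ ≤ (2 : ℝ) ^ V * (1 - ((2 : ℝ) ^ (k + 1))⁻¹) ^ Du.card := by
        gcongr _ * ?_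
        exact pow_le_pow_of_le_one hμ0 hμ1 hhalf

end PerU

/-! ### Summing over `u` -/

/-- The count of a set of pairs is the sum over the first coordinate. [folklore] -/
theorem card_filter_prod_eq_sum {α β : Type*} [Fintype α] [Fintype β] (P : α → β → Prop)
    [∀ a b, Decidable (P a b)] :
    ((Finset.univ : Finset (α × β)).filter fun p => P p.1 p.2).card =
      ∑ a : α, ((Finset.univ : Finset β).filter fun b => P a b).card := by
  classical
  rw [Finset.card_filter, ← Finset.univ_product_univ, Finset.sum_product]
  refine Finset.sum_congr rfl fun a _ => ?_
  rw [Finset.card_filter]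

/-- **Good sample points at which no term of a disjoint family is satisfied are few.** For a
pairwise variable-disjoint family `D` of consistent terms of size `≤ k` (`1 ≤ k`, `2k ≤ c`, `M ≥ 1`,
`n ≤ V`, variables `< V`):
`#{(u, y) : u good, rho u y satisfies no term of D} ≤ M^V 2^V (1 - 2^{-(k+1)} M^{-k})^{|D|}`.
[Segerlind–Buss–Impagliazzo 2004, §3 (the disjoint-terms case of the switching lemma);
Alekhnovich 2011, §4] [folklore] -/
theorem card_good_forall_not_satBy_le (hexp : IsBoundaryExpander (rowVars E) r c) (hc : 0 < c)
    (hnV : n ≤ V) (hM : 1 ≤ M) {k : ℕ} (hk1 : 1 ≤ k) (hkc : 2 * (k : ℝ) ≤ c)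
    (D : Finset (Finset (Literal ℕ))) (hdisj : PairwiseDisjointVars D)
    (hcons : ∀ t ∈ D, TConsistent t) (hk : ∀ t ∈ D, t.card ≤ k) (hV : ∀ t ∈ D, ∀ l ∈ t, l.1 < V) :
    ((((Finset.univ : Finset ((Fin V → Fin M) × (Fin V → Bool))).filter
        fun p : (Fin V → Fin M) × (Fin V → Bool) =>
        Good (n := n) r c V M p.1 ∧ ∀ t ∈ D, ¬ SatBy (rho E r c V M p.1 p.2) t).card : ℝ)) ≤
      (M : ℝ) ^ V * (2 : ℝ) ^ V * (1 - ((2 : ℝ) ^ (k + 1))⁻¹ * ((M : ℝ) ^ k)⁻¹) ^ D.card := by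
  classical
  rw [card_filter_prod_eq_sum (fun u y => Good (n := n) r c V M u ∧
    ∀ t ∈ D, ¬ SatBy (rho E r c V M u y) t)]
  push_cast
  set μ : ℝ := 1 - ((2 : ℝ) ^ (k + 1))⁻¹ with hμ
  have hμ0 : 0 ≤ μ := by
    have : ((2 : ℝ) ^ (k + 1))⁻¹ ≤ 1 := inv_le_one_of_one_le₀ (one_le_pow₀ (by norm_num))
    rw [hμ]; linarith
  have hμ1 : μ ≤ 1 := by
    have : (0 : ℝ) ≤ ((2 : ℝ) ^ (k + 1))⁻¹ := by positivity
    rw [hμ]; linarith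
  -- per-`u` bound (zero for bad `u`)
  have hper : ∀ u : Fin V → Fin M,
      ((((Finset.univ : Finset (Fin V → Bool)).filter fun y =>
          Good (n := n) r c V M u ∧ ∀ t ∈ D, ¬ SatBy (rho E r c V M u y) t).card : ℝ)) ≤
        (2 : ℝ) ^ V * μ ^ (D.filter (Landed u)).card := by
    intro u
    by_cases hu : Good (n := n) r c V M u
    · have := card_forall_not_satBy_le hexp hc hnV hk1 hkc hu D hdisj hcons hk hV
      refine le_trans ?_ this
      exact_mod_cast Finset.card_le_card fun y hy => by
        simp only [Finset.mem_filter, Finset.mem_univ, true_and] at hy ⊢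
        exact hy.2
    · have : ((Finset.univ : Finset (Fin V → Bool)).filter fun y =>
          Good (n := n) r c V M u ∧ ∀ t ∈ D, ¬ SatBy (rho E r c V M u y) t) = ∅ := by
        ext y; simp [hu]
      rw [this, Finset.card_empty, Nat.cast_zero]
      positivity
  have hgen := sum_pow_landed_le (V := V) hM D hdisj
    (fun t ht => (card_tfin_le t).trans (hk t ht)) hμ0 hμ1
  calc ∑ u : Fin V → Fin M, ((((Finset.univ : Finset (Fin V → Bool)).filter fun y =>
          Good (n := n) r c V M u ∧ ∀ t ∈ D, ¬ SatBy (rho E r c V M u y) t).card : ℝ))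
      ≤ ∑ u : Fin V → Fin M, (2 : ℝ) ^ V * μ ^ (D.filter (Landed u)).card :=
        Finset.sum_le_sum fun u _ => hper u
    _ = (2 : ℝ) ^ V * ∑ u : Fin V → Fin M, μ ^ (D.filter (Landed u)).card := by
        rw [Finset.mul_sum]
    _ ≤ (2 : ℝ) ^ V * ((M : ℝ) ^ V * (1 - (1 - μ) * ((M : ℝ) ^ k)⁻¹) ^ D.card) := by gcongr
    _ = (M : ℝ) ^ V * (2 : ℝ) ^ V * (1 - ((2 : ℝ) ^ (k + 1))⁻¹ * ((M : ℝ) ^ k)⁻¹) ^ D.card := by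
        rw [hμ]; ring

end Summit.PneNP.PneNP.Theorems.ResKRestriction
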